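import Mathlib.Analysis.SpecialFunctions.Pow.Deriv
import Mathlib.Analysis.SpecialFunctions.Complex.Arg
import Mathlib.Analysis.SpecialFunctions.Exp
import Literature.NumberTheory.Transcendental.ExpDominantSolvabilityContraction
import Literature.NumberTheory.Transcendental.ExpVarieties
import Literature.ModelTheory.ExponentialFields.Languages
import HarnessLib

/-!
# An exponential point by diagonal escape to infinity (a case outside every lattice-ray theorem)

All sub-rungs of Exponential-Algebraic Closedness proved so far in this packet (graph, cyclic-cover,
quadric-cover and hyperplane bases) find exponential points near LATTICE RAYS `x' ≈ 2πi m q`, where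
the distinguished coordinate `yₙ = e^{xₙ}` tends to the puncture at which the fibre is polynomially
glued. For the free, rotund (by dominance of `π₂`) 3-fold

  `V = {x₃ = -x₁² - x₂², y₁ = x₁ + y₃, y₂ = x₂ + y₃} ⊆ ℂ³ × (ℂˣ)³`

this is impossible: `Re(-x₁² - x₂²) → +∞` along every lattice ray, so `y₃ → ∞` while `yⱼ = xⱼ + y₃`
would have to stay of polynomial size. Zilber's conjecture still predicts `V ∩ Γ_exp ≠ ∅`
(first open rung `dim π₁ V = n - 1`, Mantova–Masser, PLMS 129 (2024), §1 p. 5). This file proves it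
by a different mechanism — *all coordinates escape to infinity together along the diagonal*: on
`x₁ = x₂ = z` the system collapses to `e^z = z + e^{-2z²}`, solved near `z ≈ e^{-iπ/4} √(πk)`
(`k → ∞`) by the substitution `ζ = -2z² - z - 2πik`, `z(ζ) = (-1 + √(1 - 8ζ - 16πik))/4`, which turns
it into `e^{ζ} = 1 - z(ζ) e^{-z(ζ)}` with `|z e^{-z}| ≤ 3√k e^{-√k/4}`, a case of the one-variable
contraction lemma `Literature.NumberTheory.Transcendental.ExpDominant.exists_exp_eq_one_add`.

* `re_sqrt_lower_bound` — `Re √D ≥ 2√k` and `‖√D‖ ≤ 9√k` for `D = 1 - 8ζ - 16πik`, `‖ζ‖ < 1`;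
* `exists_exp_eq_self_add_exp_neg_two_sq` — `∃ z, e^z = z + e^{-2z²}`;
* `mismatchParaboloid_inter_expGraph_nonempty` — `V ∩ Γ_exp ≠ ∅` for the 3-fold above.

HONEST FRAMING: one explicit new case of EAC (a data point for the "puncture/gluing mismatch" class,
which the packet's census records as open in general); nothing here bears on Schanuel's conjecture.
-/

noncomputable section

open Complex Metric Set Filter Topology

set_option linter.dupNamespace false

namespace Summit.Schanuel.Schanuel.Theorems

/-- **The principal square root of `D = 1 - 8ζ - 16πik`** (`‖ζ‖ < 1`, `k ≥ 1`): `D` is off the cut,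
`(√D)² = D`, `Re √D ≥ 2√k` and `‖√D‖ ≤ 9√k`. (Since `Im D < 0`, `|arg D| < π`, so `Re √D > 0`;
`(Re √D)² = (|D| + Re D)/2 ≥ (16πk - 15)/2 ≥ 4k`; `|D| ≤ 16πk + 17 ≤ 81k`.) [folklore] -/
theorem re_sqrt_lower_bound {ζ : ℂ} (hζ : ‖ζ‖ < 1) {k : ℕ} (hk : 1 ≤ k) :
    (1 - 8 * ζ - 16 * Real.pi * I * k : ℂ) ∈ slitPlane ∧
    ((1 - 8 * ζ - 16 * Real.pi * I * k : ℂ) ^ ((2 : ℂ)⁻¹)) ^ 2 = 1 - 8 * ζ - 16 * Real.pi * I * k ∧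
    2 * Real.sqrt k ≤ ((1 - 8 * ζ - 16 * Real.pi * I * k : ℂ) ^ ((2 : ℂ)⁻¹)).re ∧
    ‖(1 - 8 * ζ - 16 * Real.pi * I * k : ℂ) ^ ((2 : ℂ)⁻¹)‖ ≤ 9 * Real.sqrt k := by
  set D : ℂ := 1 - 8 * ζ - 16 * Real.pi * I * k with hD
  have hk1 : (1 : ℝ) ≤ k := by exact_mod_cast hk
  have hpi : (2 : ℝ) ≤ Real.pi := Real.two_le_pi
  have hpi4 : Real.pi ≤ 4 := Real.pi_le_four
  have hζre : |ζ.re| < 1 := lt_of_le_of_lt (Complex.abs_re_le_norm ζ) hζ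
  have hζim : |ζ.im| < 1 := lt_of_le_of_lt (Complex.abs_im_le_norm ζ) hζ
  rw [abs_lt] at hζre hζim
  have hDre : D.re = 1 - 8 * ζ.re := by simp [hD]
  have hDim : D.im = -8 * ζ.im - 16 * Real.pi * k := by simp [hD]
  have hDim_neg : D.im < 0 := by rw [hDim]; nlinarith
  have hDslit : D ∈ slitPlane := mem_slitPlane_iff.mpr (Or.inr hDim_neg.ne)
  have hD0 : D ≠ 0 := slitPlane_ne_zero hDslit
  set w : ℂ := D ^ ((2 : ℂ)⁻¹) with hw
  have hsq : w ^ 2 = D := by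
    have h := Complex.cpow_nat_inv_pow D (n := 2) two_ne_zero
    simp only [Nat.cast_ofNat] at h
    exact h
  -- `Re w > 0`
  have hwre : 0 < w.re := by
    rw [hw, Complex.cpow_def_of_ne_zero hD0, Complex.exp_re]
    refine mul_pos (Real.exp_pos _) (Real.cos_pos_of_mem_Ioo ?_)
    have harg1 : Complex.arg D < Real.pi := Complex.arg_lt_pi_iff.mpr (Or.inr hDim_neg.ne)
    have harg2 : -Real.pi < Complex.arg D := Complex.neg_pi_lt_arg D
    have h2 : (2 : ℂ)⁻¹ = ((2⁻¹ : ℝ) : ℂ) := by push_cast; rfl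
    have him : (Complex.log D * (2 : ℂ)⁻¹).im = Complex.arg D / 2 := by
      rw [h2, Complex.mul_im, Complex.ofReal_re, Complex.ofReal_im, mul_zero, zero_add,
        Complex.log_im]
      ring
    rw [him, Set.mem_Ioo]
    constructor <;> linarith
  -- `(Re w)² = (‖D‖ + Re D)/2`
  have hnormD : ‖D‖ = w.re ^ 2 + w.im ^ 2 := by
    rw [← hsq, norm_pow, Complex.sq_norm, Complex.normSq_apply]; ring
  have hreD : D.re = w.re ^ 2 - w.im ^ 2 := by
    rw [← hsq]; simp [sq, Complex.mul_re]
  have hre2 : w.re ^ 2 = (‖D‖ + D.re) / 2 := by rw [hnormD, hreD]; ring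
  -- bounds on `‖D‖`
  have hDlow : 16 * Real.pi * k - 8 ≤ ‖D‖ := by
    have h1 : |D.im| ≤ ‖D‖ := Complex.abs_im_le_norm D
    rw [hDim] at h1
    have h2 : |(-8 * ζ.im - 16 * Real.pi * k)| ≥ 16 * Real.pi * k - 8 := by
      rw [abs_of_neg (by nlinarith)]; nlinarith
    linarith
  have hDupp : ‖D‖ ≤ 16 * Real.pi * k + 17 := by
    have h1 : ‖D‖ ≤ |D.re| + |D.im| := Complex.norm_le_abs_re_add_abs_im D
    rw [hDre, hDim] at h1
    have h2 : |1 - 8 * ζ.re| ≤ 9 := by rw [abs_le]; constructor <;> linarith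
    have h3 : |(-8 * ζ.im - 16 * Real.pi * k)| ≤ 8 + 16 * Real.pi * k := by
      rw [abs_le]; constructor <;> nlinarith
    linarith
  refine ⟨hDslit, hsq, ?_, ?_⟩
  · -- `Re w ≥ 2√k`
    have h1 : 4 * (k : ℝ) ≤ w.re ^ 2 := by
      rw [hre2, hDre]; nlinarith
    have h3 : Real.sqrt (4 * k) ≤ Real.sqrt (w.re ^ 2) := Real.sqrt_le_sqrt h1
    rw [Real.sqrt_sq hwre.le, Real.sqrt_mul (by norm_num : (0:ℝ) ≤ 4),
      show (4 : ℝ) = 2 ^ 2 by norm_num, Real.sqrt_sq (by norm_num : (0:ℝ) ≤ 2)] at h3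
    exact h3
  · -- `‖w‖ ≤ 9√k`
    have h1 : ‖w‖ ^ 2 = ‖D‖ := by rw [← norm_pow, hsq]
    have h2 : ‖w‖ ^ 2 ≤ (9 * Real.sqrt k) ^ 2 := by
      rw [h1, mul_pow, Real.sq_sqrt (by positivity)]
      nlinarith
    exact (pow_le_pow_iff_left₀ (norm_nonneg _) (by positivity) two_ne_zero).mp h2

/-- **`e^z = z + e^{-2z²}` has a solution** (indeed one near `e^{-iπ/4}√(πk)` for every large `k`).
Substituting `ζ = -2z² - z - 2πik`, `z(ζ) = (-1 + √(1 - 8ζ - 16πik))/4`, the equation becomes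
`e^{ζ} = 1 - z(ζ) e^{-z(ζ)}` on `‖ζ‖ < 1`, where `Re z(ζ) ≥ √k/4` and `|z(ζ)| ≤ 3√k`, so the
right-hand side is `1 + O(√k e^{-√k/4})`: the one-variable case of the contraction lemma
`Literature.NumberTheory.Transcendental.ExpDominant.exists_exp_eq_one_add`. New.
[cite: MantovaMasser2023, §1 p.5 (the open case dim π(V) = 2 in ℂ³×ℂˣ³)] -/
theorem exists_exp_eq_self_add_exp_neg_two_sq : ∃ z : ℂ, exp z = z + exp (-2 * z ^ 2) := by
  -- choose `k` with `3√k e^{-√k/4} ≤ 1/32`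
  have hsmall : ∀ᶠ k : ℕ in atTop, 3 * Real.sqrt k * Real.exp (-(Real.sqrt k / 4)) ≤ 1 / 32 := by
    have h1 : Tendsto (fun k : ℕ => Real.sqrt k / 4) atTop atTop := by
      refine Tendsto.atTop_div_const (by norm_num) ?_
      exact Real.tendsto_sqrt_atTop.comp tendsto_natCast_atTop_atTop
    have h2 := ((Real.tendsto_pow_mul_exp_neg_atTop_nhds_zero 1).comp h1).const_mul 12
    rw [mul_zero] at h2
    refine (h2.eventually (eventually_le_nhds (by norm_num : (0:ℝ) < 1 / 32))).mono fun k hk => ?_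
    have : 12 * ((fun x : ℝ => x ^ 1 * Real.exp (-x)) ∘ fun k : ℕ => Real.sqrt k / 4) k =
        3 * Real.sqrt k * Real.exp (-(Real.sqrt k / 4)) := by
      simp only [Function.comp, pow_one]; ring
    rw [this] at hk
    exact hk
  obtain ⟨k, hk, hk1⟩ := (hsmall.and (eventually_ge_atTop 1)).exists
  have hk1r : (1 : ℝ) ≤ k := by exact_mod_cast hk1
  have hsk1 : 1 ≤ Real.sqrt k := by
    rw [show (1:ℝ) = Real.sqrt 1 by simp]; exact Real.sqrt_le_sqrt hk1r
  -- the branch `z(ζ)` and the perturbation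
  set D : ℂ → ℂ := fun ζ => 1 - 8 * ζ - 16 * Real.pi * I * k with hDdef
  set zf : ℂ → ℂ := fun ζ => (-1 + (D ζ) ^ ((2 : ℂ)⁻¹)) / 4 with hzf
  set g : Fin 1 → (Fin 1 → ℂ) → ℂ := fun _ ξ => -(zf (ξ 0)) * exp (-(zf (ξ 0))) with hg
  -- estimates on the unit disc
  have hest : ∀ ζ : ℂ, ‖ζ‖ < 1 → Real.sqrt k / 4 ≤ (zf ζ).re ∧ ‖zf ζ‖ ≤ 3 * Real.sqrt k := by
    intro ζ hζ
    obtain ⟨-, -, hre, hnorm⟩ := re_sqrt_lower_bound hζ hk1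
    constructor
    · show Real.sqrt k / 4 ≤ ((-1 + (D ζ) ^ ((2 : ℂ)⁻¹)) / 4).re
      rw [Complex.div_ofNat_re, Complex.add_re, Complex.neg_re, Complex.one_re]
      have : ((1 - 8 * ζ - 16 * Real.pi * I * k : ℂ) ^ ((2 : ℂ)⁻¹)).re = ((D ζ) ^ ((2 : ℂ)⁻¹)).re := rfl
      linarith
    · show ‖(-1 + (D ζ) ^ ((2 : ℂ)⁻¹)) / 4‖ ≤ 3 * Real.sqrt k
      rw [norm_div, Complex.norm_ofNat]
      have h1 : ‖-1 + (D ζ) ^ ((2 : ℂ)⁻¹)‖ ≤ 1 + 9 * Real.sqrt k := by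
        refine (norm_add_le _ _).trans ?_
        rw [norm_neg, norm_one]
        have : ‖(1 - 8 * ζ - 16 * Real.pi * I * k : ℂ) ^ ((2 : ℂ)⁻¹)‖ = ‖(D ζ) ^ ((2 : ℂ)⁻¹)‖ := rfl
        linarith
      rw [div_le_iff₀ (by norm_num : (0:ℝ) < 4)]
      linarith
  -- holomorphy of the perturbation on the unit polydisc of `ℂ¹`
  have hgdiff : ∀ j, DifferentiableOn ℂ (g j) (ball 0 1) := by
    intro j
    have hD_diff : Differentiable ℂ D := by
      show Differentiable ℂ fun ζ => 1 - 8 * ζ - 16 * Real.pi * I * k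
      fun_prop
    have hzf_diff : DifferentiableOn ℂ zf {ζ : ℂ | ‖ζ‖ < 1} := by
      have h1 : DifferentiableOn ℂ (fun ζ => (D ζ) ^ ((2 : ℂ)⁻¹)) {ζ : ℂ | ‖ζ‖ < 1} :=
        hD_diff.differentiableOn.cpow (differentiableOn_const _)
          (fun ζ hζ => (re_sqrt_lower_bound hζ hk1).1)
      show DifferentiableOn ℂ (fun ζ => (-1 + (D ζ) ^ ((2 : ℂ)⁻¹)) / 4) _
      exact ((differentiableOn_const _).add h1).div_const _
    have hproj : MapsTo (fun ξ : Fin 1 → ℂ => ξ 0) (ball 0 1) {ζ : ℂ | ‖ζ‖ < 1} := by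
      intro ξ hξ
      rw [mem_ball, dist_zero_right] at hξ
      exact lt_of_le_of_lt (norm_le_pi_norm ξ 0) hξ
    have hz0 : DifferentiableOn ℂ (fun ξ : Fin 1 → ℂ => zf (ξ 0)) (ball 0 1) :=
      hzf_diff.comp (differentiable_apply (0 : Fin 1)).differentiableOn hproj
    exact hz0.neg.mul hz0.neg.cexp
  have hgbound : ∀ j, ∀ ξ ∈ ball (0 : Fin 1 → ℂ) 1, ‖g j ξ‖ ≤ 1 / 32 := by
    intro j ξ hξ
    rw [mem_ball, dist_zero_right] at hξ
    have hζ : ‖ξ 0‖ < 1 := lt_of_le_of_lt (norm_le_pi_norm ξ 0) hξ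
    obtain ⟨hre, hnorm⟩ := hest (ξ 0) hζ
    show ‖-(zf (ξ 0)) * exp (-(zf (ξ 0)))‖ ≤ 1 / 32
    rw [norm_mul, norm_neg, Complex.norm_exp, Complex.neg_re]
    calc ‖zf (ξ 0)‖ * Real.exp (-(zf (ξ 0)).re)
        ≤ 3 * Real.sqrt k * Real.exp (-(Real.sqrt k / 4)) :=
          mul_le_mul hnorm (Real.exp_le_exp.mpr (by linarith)) (Real.exp_pos _).le (by positivity)
      _ ≤ 1 / 32 := hk
  obtain ⟨ξ, hξ, hfix⟩ := Literature.NumberTheory.Transcendental.ExpDominant.exists_exp_eq_one_add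
    g (ε := 1 / 32) (by norm_num) (by norm_num) hgdiff hgbound
  -- unwind the substitution
  set ζ : ℂ := ξ 0 with hζdef
  have hζ1 : ‖ζ‖ < 1 := lt_of_le_of_lt ((norm_le_pi_norm ξ 0).trans hξ) (by norm_num)
  set z : ℂ := zf ζ with hzdef
  obtain ⟨-, hsq, -, -⟩ := re_sqrt_lower_bound hζ1 hk1
  have hzrel : ζ = -2 * z ^ 2 - z - 2 * Real.pi * I * k := by
    have h4 : 4 * z + 1 = (D ζ) ^ ((2 : ℂ)⁻¹) := by rw [hzdef, hzf]; ring
    have h5 : (4 * z + 1) ^ 2 = 1 - 8 * ζ - 16 * Real.pi * I * k := by rw [h4]; exact hsq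
    linear_combination (1 / 8 : ℂ) * h5
  have hmain := hfix 0
  refine ⟨z, ?_⟩
  have hexpζ : exp ζ = 1 - z * exp (-z) := by
    rw [hmain]
    show 1 + -z * exp (-z) = 1 - z * exp (-z)
    ring
  have hk2 : exp (2 * Real.pi * I * k) = 1 := by
    rw [show (2 * (Real.pi : ℂ) * I * k) = ((k : ℤ) : ℂ) * (2 * Real.pi * I) by push_cast; ring]
    exact Complex.exp_int_mul_two_pi_mul_I _
  -- `e^{-2z²} = e^{ζ + z} · e^{2πik} = (1 - z e^{-z}) e^{z} = e^{z} - z`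
  have h1 : exp (-2 * z ^ 2) = exp ζ * exp z * exp (2 * Real.pi * I * k) := by
    rw [← Complex.exp_add, ← Complex.exp_add]
    congr 1
    rw [hzrel]; ring
  rw [h1, hk2, mul_one, hexpζ, sub_mul, one_mul, mul_assoc, ← Complex.exp_add, neg_add_cancel,
    Complex.exp_zero, mul_one]
  ring

/-- **The "mismatch" paraboloid 3-fold meets the graph of exponentiation.** The subvariety
`V = {x₃ = -x₁² - x₂², y₁ = x₁ + y₃, y₂ = x₂ + y₃}` of `ℂ³ × ℂ³` — additively free, `π₂` bijective
onto its image (hence multiplicatively free and rotund), `dim π₁ V = 2`, and such that along EVERY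
lattice ray `y₃ → ∞` (so that none of the lattice-ray theorems of this packet applies) — contains a
point of `Literature.NumberTheory.Transcendental.expGraph ℂ 3`: the diagonal point
`(z, z, -2z², e^z, e^z, e^{-2z²})` with `e^z = z + e^{-2z²}`. New (EC for this `V`; first open rung,
Mantova–Masser 2024 §1 p. 5). [cite: MantovaMasser2023, §1 p.5 (the open case dim π(V) = 2 in ℂ³×ℂˣ³)] -/
theorem mismatchParaboloid_inter_expGraph_nonempty :
    ({p : Fin 3 ⊕ Fin 3 → ℂ |
        p (Sum.inl 2) = -(p (Sum.inl 0)) ^ 2 - (p (Sum.inl 1)) ^ 2 ∧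
        p (Sum.inr 0) = p (Sum.inl 0) + p (Sum.inr 2) ∧
        p (Sum.inr 1) = p (Sum.inl 1) + p (Sum.inr 2)} ∩
      Literature.NumberTheory.Transcendental.expGraph ℂ 3).Nonempty := by
  obtain ⟨z, hz⟩ := exists_exp_eq_self_add_exp_neg_two_sq
  have hz' : exp z = z + exp (-(2 * z ^ 2)) := by
    rw [show -(2 * z ^ 2) = -2 * z ^ 2 by ring]; exact hz
  set X : Fin 3 → ℂ := ![z, z, -2 * z ^ 2] with hX
  refine ⟨Sum.elim X fun i => exp (X i), ⟨?_, ?_, ?_⟩, fun i => ?_⟩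
  · simp [hX]; ring
  · simp [hX]
    first | linear_combination hz | linear_combination hz'
  · simp [hX]
    first | linear_combination hz | linear_combination hz'
  · simp [Literature.ModelTheory.ExponentialFields.ExponentialRing.complex_exp_eq]

end Summit.Schanuel.Schanuel.Theorems
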